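import Mathlib
import Literature.Computability.AlgebraicComplexity.MatrixMultiplicationExponent
import Literature.Computability.AlgebraicComplexity.FlatteningBound
import Literature.Computability.AlgebraicComplexity.KroneckerRank

/-!
# MatrixMultiplication / ShapeSubmodularity — `ShapeSubmodular`, the unit cell from a flat meet

Route `ShapeSubmodularity`, crux `ShapeSubmodular` (stmt-MatrixMultiplication-15622), line
`registered` (skeleton `Cruxes/ShapeSubmodular/Lines/birth.lean`, RESHAPE 3), stub
`stub_cellOfFlatMeet`.

Write `R(x,y,z)` for `n ↦ R⟨n^x, n^y, n^z⟩ = tensorRank (matMulTensor ℂ (n^x) (n^y) (n^z))` and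
`L = max(a+b, b+c, a+c)` for the flattening value of the format `(a,b,c)`.  If the MEET `(a,b,c)` of the
unit cell `{a, a+1} × {b, b+1} × {c}` has the flattening exponent (for every `ε > 0`,
`R(a,b,c) = O(n^{L+ε})`), the unit-square exchange law holds at that cell: admissible `β` for
`R(a+1,b,c)` and `β'` for `R(a,b+1,c)` give, for every `ε > 0`, admissible `γ` for the join
`R(a+1,b+1,c)` and `γ'` for the meet `R(a,b,c)` with `γ + γ' ≤ β + β' + ε`.

Proof.  Always `γ' = L + ε` (the hypothesis on the meet).

* `b < a ∧ b < c` (`L = a + c`): `γ = β' + 1` by BLOCKING the first outer dimension of the join,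
  `R⟨n^a · n, n^(b+1), n^c⟩ ≤ n · R⟨n^a, n^(b+1), n^c⟩` (Kronecker product with `⟨n, 1, 1⟩` of rank
  `≤ n`; Bläser 2013, Lemma 5.8 and p. 24), and the flattening lower bound on the FIRST hypothesis
  format, `n^(a+1) · n^c ≤ R⟨n^(a+1), n^b, n^c⟩`, forces `L + 1 = a + c + 1 ≤ β`.
* otherwise (`a ≤ b ∨ c ≤ b`): `γ = β + 1` by blocking the inner dimension of the join,
  `R⟨n^(a+1), n^b · n, n^c⟩ ≤ n · R⟨n^(a+1), n^b, n^c⟩`, and flattening on the SECOND hypothesis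
  format forces `L + 1 ≤ β'`: `n^a · n^(b+1) ≤ R⟨n^a, n^(b+1), n^c⟩` if `c ≤ a` (`L = a + b`),
  `n^(b+1) · n^c ≤ R⟨n^a, n^(b+1), n^c⟩` if `a < c` (`L = b + c`).
-/

-- the tree's namespace `Summit.MatrixMultiplication.MatrixMultiplication.…` repeats a component by
-- design
set_option linter.dupNamespace false

open Filter Asymptotics
open Literature.Computability.AlgebraicComplexity

namespace Summit.MatrixMultiplication.MatrixMultiplication.Theorems.ShapeSubmodular

/-! ## `O`-bookkeeping for `ℕ`-valued sequences against real powers `n ↦ n^β` -/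

/-- A polynomial lower bound forces the exponent: if `n^k ≤ R n` for `n ≥ 1` and `R = O(n^β)`, then
`k ≤ β` (otherwise `n^{k-β} → ∞` would be bounded). [folklore] -/
private theorem cell_le_of_isBigO (R : ℕ → ℕ) (k : ℕ) (β : ℝ)
    (h : ∀ n : ℕ, 0 < n → n ^ k ≤ R n)
    (hO : (fun n : ℕ => (R n : ℝ)) =O[atTop] (fun n : ℕ => (n : ℝ) ^ β)) :
    (k : ℝ) ≤ β := by
  -- adapted from `Theorems.ShapeSubmodular.boundary_le_of_isBigO` (stub_unitExchangeBoundary)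
  by_contra hlt
  rw [not_le] at hlt
  obtain ⟨C, hC⟩ := isBigO_iff.1 hO
  have hev : ∀ᶠ n : ℕ in atTop, (n : ℝ) ^ ((k : ℝ) - β) ≤ C := by
    filter_upwards [hC, eventually_gt_atTop 0] with n hn hn0
    have hn0' : (0 : ℝ) < n := Nat.cast_pos.2 hn0
    rw [Real.norm_of_nonneg (Nat.cast_nonneg _),
      Real.norm_of_nonneg (Real.rpow_nonneg (Nat.cast_nonneg _) _)] at hn
    have hsq : (n : ℝ) ^ (k : ℝ) ≤ C * (n : ℝ) ^ β := by
      refine le_trans ?_ hn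
      rw [Real.rpow_natCast]
      exact_mod_cast h n hn0
    rw [Real.rpow_sub hn0', div_le_iff₀ (Real.rpow_pos_of_pos hn0' _)]
    exact hsq
  have hlim : Tendsto (fun n : ℕ => (n : ℝ) ^ ((k : ℝ) - β)) atTop atTop :=
    (tendsto_rpow_atTop (by linarith)).comp tendsto_natCast_atTop_atTop
  obtain ⟨n, hn₁, hn₂⟩ := (hev.and (hlim.eventually_gt_atTop C)).exists
  exact absurd hn₁ (not_le.2 hn₂)

/-- One extra factor of `n`: if `R' n ≤ n · R n` and `R = O(n^β)`, then `R' = O(n^{β+1})`.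
[folklore] -/
private theorem cell_isBigO_mul (R R' : ℕ → ℕ) (β : ℝ) (h : ∀ n : ℕ, R' n ≤ n * R n)
    (hO : (fun n : ℕ => (R n : ℝ)) =O[atTop] (fun n : ℕ => (n : ℝ) ^ β)) :
    (fun n : ℕ => (R' n : ℝ)) =O[atTop] (fun n : ℕ => (n : ℝ) ^ (β + 1)) := by
  -- adapted from `Theorems.ShapeSubmodular.boundary_isBigO_mul` (stub_unitExchangeBoundary)
  have h1 : (fun n : ℕ => (R' n : ℝ)) =O[atTop] (fun n : ℕ => (R n : ℝ) * (n : ℝ)) := by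
    refine IsBigO.of_bound 1 (Eventually.of_forall fun n => ?_)
    rw [one_mul, Real.norm_of_nonneg (Nat.cast_nonneg _), Real.norm_of_nonneg (by positivity)]
    calc (R' n : ℝ) ≤ ((n * R n : ℕ) : ℝ) := by exact_mod_cast h n
      _ = (R n : ℝ) * n := by push_cast; ring
  have h2 : (fun n : ℕ => (R n : ℝ) * (n : ℝ)) =O[atTop] (fun n : ℕ => (n : ℝ) ^ β * (n : ℝ)) :=
    hO.mul (isBigO_refl _ _)
  have h3 : (fun n : ℕ => (n : ℝ) ^ β * (n : ℝ)) =ᶠ[atTop] (fun n : ℕ => (n : ℝ) ^ (β + 1)) := by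
    filter_upwards [eventually_gt_atTop 0] with n hn0
    rw [Real.rpow_add_one (Nat.cast_pos.2 hn0).ne']
  exact (h1.trans h2).trans h3.isBigO

/-! ## Transport and blocking of matrix multiplication ranks -/

/-- Transport of the rank along equalities of the three formats. [folklore] -/
private theorem cell_rank_congr {k k' m m' l l' : ℕ} (hk : k = k') (hm : m = m')
    (hl : l = l') :
    tensorRank (matMulTensor ℂ k m l) = tensorRank (matMulTensor ℂ k' m' l') := by
  subst hk; subst hm; subst hl; rfl

/-- Blocking in the inner dimension: `R⟨k, m·n, l⟩ ≤ n · R⟨k, m, l⟩` (Kronecker product with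
`⟨1, n, 1⟩`, whose rank is `≤ n` by the standard algorithm). [cite: Blaser2013, Lemma 5.8 and p. 24] -/
private theorem cell_rank_mul_mid_le (k m l n : ℕ) :
    tensorRank (matMulTensor ℂ k (m * n) l) ≤ n * tensorRank (matMulTensor ℂ k m l) := by
  -- adapted from `Theorems.ShapeSubmodular.boundary_rank_mul_mid_le` (stub_unitExchangeBoundary)
  have h := Blaser2013_rank_matMulTensor_mul_le ℂ k m l 1 n 1
  rw [mul_one k, mul_one l] at h
  calc tensorRank (matMulTensor ℂ k (m * n) l)
        ≤ tensorRank (matMulTensor ℂ k m l) * tensorRank (matMulTensor ℂ 1 n 1) := h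
    _ ≤ tensorRank (matMulTensor ℂ k m l) * n := by
        refine Nat.mul_le_mul_left _ ?_
        simpa using tensorRank_matMulTensor_le ℂ 1 n 1
    _ = n * tensorRank (matMulTensor ℂ k m l) := mul_comm _ _

/-- Blocking in the first outer dimension: `R⟨k·n, m, l⟩ ≤ n · R⟨k, m, l⟩` (Kronecker product with
`⟨n, 1, 1⟩`, whose rank is `≤ n` by the standard algorithm). [cite: Blaser2013, Lemma 5.8 and p. 24] -/
private theorem cell_rank_mul_left_le (k m l n : ℕ) :
    tensorRank (matMulTensor ℂ (k * n) m l) ≤ n * tensorRank (matMulTensor ℂ k m l) := by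
  -- adapted from `Theorems.ShapeSubmodular.boundary_rank_mul_left_le` (stub_unitExchangeBoundary)
  have h := Blaser2013_rank_matMulTensor_mul_le ℂ k m l n 1 1
  rw [mul_one m, mul_one l] at h
  calc tensorRank (matMulTensor ℂ (k * n) m l)
        ≤ tensorRank (matMulTensor ℂ k m l) * tensorRank (matMulTensor ℂ n 1 1) := h
    _ ≤ tensorRank (matMulTensor ℂ k m l) * n := by
        refine Nat.mul_le_mul_left _ ?_
        simpa using tensorRank_matMulTensor_le ℂ n 1 1
    _ = n * tensorRank (matMulTensor ℂ k m l) := mul_comm _ _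

/-! ## The stub -/

/-- **The unit cell from a flat meet** (stub `stub_cellOfFlatMeet` of the line `registered` of
crux `ShapeSubmodular`): if the meet `(a,b,c)` has the flattening exponent (for every `ε > 0`,
`R⟨n^a, n^b, n^c⟩ = O(n^{L+ε})`, `L = max(a+b, b+c, a+c)`), then admissible `β` for
`R⟨n^(a+1), n^b, n^c⟩` and `β'` for `R⟨n^a, n^(b+1), n^c⟩` give, for every `ε > 0`, admissible `γ`
for `R⟨n^(a+1), n^(b+1), n^c⟩` and `γ'` for `R⟨n^a, n^b, n^c⟩` with `γ + γ' ≤ β + β' + ε`.  Proof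
by one-decade blocking on the join (`Blaser2013_rank_matMulTensor_mul_le`,
`tensorRank_matMulTensor_le`) and the flattening lower bound on the opposite hypothesis format
(`mul_le_tensorRank_matMulTensor{,_left,_right}`), with `γ' = L + ε`. [folklore] -/
theorem stub_cellOfFlatMeet :
    ∀ a b c : ℕ,
      (∀ ε : ℝ, 0 < ε →
        (fun n : ℕ => (Literature.Computability.AlgebraicComplexity.tensorRank
          (Literature.Computability.AlgebraicComplexity.matMulTensor ℂ (n ^ a) (n ^ b) (n ^ c)) : ℝ))
            =O[Filter.atTop]
              (fun n : ℕ => (n : ℝ) ^ (((max (a + b) (max (b + c) (a + c)) : ℕ) : ℝ) + ε))) →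
      ∀ β β' : ℝ,
      (fun n : ℕ => (Literature.Computability.AlgebraicComplexity.tensorRank
        (Literature.Computability.AlgebraicComplexity.matMulTensor ℂ (n ^ (a + 1)) (n ^ b) (n ^ c)) : ℝ))
          =O[Filter.atTop] (fun n : ℕ => (n : ℝ) ^ β) →
      (fun n : ℕ => (Literature.Computability.AlgebraicComplexity.tensorRank
        (Literature.Computability.AlgebraicComplexity.matMulTensor ℂ (n ^ a) (n ^ (b + 1)) (n ^ c)) : ℝ))
          =O[Filter.atTop] (fun n : ℕ => (n : ℝ) ^ β') →
      ∀ ε : ℝ, 0 < ε → ∃ γ γ' : ℝ, γ + γ' ≤ β + β' + ε ∧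
        (fun n : ℕ => (Literature.Computability.AlgebraicComplexity.tensorRank
          (Literature.Computability.AlgebraicComplexity.matMulTensor ℂ
            (n ^ (a + 1)) (n ^ (b + 1)) (n ^ c)) : ℝ))
            =O[Filter.atTop] (fun n : ℕ => (n : ℝ) ^ γ) ∧
        (fun n : ℕ => (Literature.Computability.AlgebraicComplexity.tensorRank
          (Literature.Computability.AlgebraicComplexity.matMulTensor ℂ (n ^ a) (n ^ b) (n ^ c)) : ℝ))
            =O[Filter.atTop] (fun n : ℕ => (n : ℝ) ^ γ') := by
  intro a b c hL β β' h₁ h₂ ε hε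
  by_cases hb : b < a ∧ b < c
  · -- `b` is the strict minimum: `L = a + c`; block the first outer dimension of the join and
    -- flatten the first hypothesis format
    have hLeq : (max (a + b) (max (b + c) (a + c)) : ℕ) = a + c := by omega
    have hβ : ((a + c + 1 : ℕ) : ℝ) ≤ β := by
      refine cell_le_of_isBigO
        (fun n => tensorRank (matMulTensor ℂ (n ^ (a + 1)) (n ^ b) (n ^ c))) (a + c + 1) β
        (fun n hn => ?_) h₁
      haveI : NeZero (n ^ b) := ⟨(pow_pos hn b).ne'⟩
      calc n ^ (a + c + 1) = n ^ (a + 1) * n ^ c := by ring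
        _ ≤ tensorRank (matMulTensor ℂ (n ^ (a + 1)) (n ^ b) (n ^ c)) :=
          mul_le_tensorRank_matMulTensor ℂ (n ^ (a + 1)) (n ^ b) (n ^ c)
    refine ⟨β' + 1, ((max (a + b) (max (b + c) (a + c)) : ℕ) : ℝ) + ε, ?_, ?_, hL ε hε⟩
    · rw [hLeq]
      push_cast at hβ ⊢
      linarith
    · refine cell_isBigO_mul
        (fun n => tensorRank (matMulTensor ℂ (n ^ a) (n ^ (b + 1)) (n ^ c)))
        (fun n => tensorRank (matMulTensor ℂ (n ^ (a + 1)) (n ^ (b + 1)) (n ^ c))) β'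
        (fun n => ?_) h₂
      calc tensorRank (matMulTensor ℂ (n ^ (a + 1)) (n ^ (b + 1)) (n ^ c))
            = tensorRank (matMulTensor ℂ (n ^ a * n) (n ^ (b + 1)) (n ^ c)) :=
          cell_rank_congr (pow_succ n a) rfl rfl
        _ ≤ n * tensorRank (matMulTensor ℂ (n ^ a) (n ^ (b + 1)) (n ^ c)) :=
          cell_rank_mul_left_le _ _ _ _
  · -- `a ≤ b ∨ c ≤ b`: block the inner dimension of the join and flatten the second hypothesis
    -- format (`L = a + b` if `c ≤ a`, `L = b + c` if `a < c`)
    have hβ' : ((max (a + b) (max (b + c) (a + c)) + 1 : ℕ) : ℝ) ≤ β' := by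
      refine cell_le_of_isBigO
        (fun n => tensorRank (matMulTensor ℂ (n ^ a) (n ^ (b + 1)) (n ^ c)))
        (max (a + b) (max (b + c) (a + c)) + 1) β' (fun n hn => ?_) h₂
      by_cases hca : c ≤ a
      · have hLeq : (max (a + b) (max (b + c) (a + c)) : ℕ) = a + b := by omega
        haveI : NeZero (n ^ c) := ⟨(pow_pos hn c).ne'⟩
        calc n ^ (max (a + b) (max (b + c) (a + c)) + 1) = n ^ a * n ^ (b + 1) := by
              rw [hLeq]; ring
          _ ≤ tensorRank (matMulTensor ℂ (n ^ a) (n ^ (b + 1)) (n ^ c)) :=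
            mul_le_tensorRank_matMulTensor_left ℂ (n ^ a) (n ^ (b + 1)) (n ^ c)
      · have hLeq : (max (a + b) (max (b + c) (a + c)) : ℕ) = b + c := by omega
        haveI : NeZero (n ^ a) := ⟨(pow_pos hn a).ne'⟩
        calc n ^ (max (a + b) (max (b + c) (a + c)) + 1) = n ^ (b + 1) * n ^ c := by
              rw [hLeq]; ring
          _ ≤ tensorRank (matMulTensor ℂ (n ^ a) (n ^ (b + 1)) (n ^ c)) :=
            mul_le_tensorRank_matMulTensor_right ℂ (n ^ a) (n ^ (b + 1)) (n ^ c)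
    refine ⟨β + 1, ((max (a + b) (max (b + c) (a + c)) : ℕ) : ℝ) + ε, ?_, ?_, hL ε hε⟩
    · push_cast at hβ' ⊢
      linarith
    · refine cell_isBigO_mul
        (fun n => tensorRank (matMulTensor ℂ (n ^ (a + 1)) (n ^ b) (n ^ c)))
        (fun n => tensorRank (matMulTensor ℂ (n ^ (a + 1)) (n ^ (b + 1)) (n ^ c))) β
        (fun n => ?_) h₁
      calc tensorRank (matMulTensor ℂ (n ^ (a + 1)) (n ^ (b + 1)) (n ^ c))
            = tensorRank (matMulTensor ℂ (n ^ (a + 1)) (n ^ b * n) (n ^ c)) :=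
          cell_rank_congr rfl (pow_succ n b) rfl
        _ ≤ n * tensorRank (matMulTensor ℂ (n ^ (a + 1)) (n ^ b) (n ^ c)) :=
          cell_rank_mul_mid_le _ _ _ _

end Summit.MatrixMultiplication.MatrixMultiplication.Theorems.ShapeSubmodular
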